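import Literature.NumberTheory.EllipticCurves.H1CorestrictionIndexTwo
import Mathlib.Topology.Algebra.Group.Quotient
import Mathlib.GroupTheory.Index
import Mathlib.Algebra.Group.Action.Basic
import HarnessLib

/-!
# Corestriction on continuous `H¹` along an open subgroup of finite index; `res ∘ cores = Nm`
(Clark–Sharif 2010, Lemma 15)

Generic continuous group cohomology (no number theory), on the tree's model of `H¹_cont(G, M)`
for a topological group `G` and a discrete `G`-module `M`
(`Literature.NumberTheory.EllipticCurves.discreteH1` = Mathlib's `continuousCohomology 1`,
explicit continuous crossed homomorphisms `Literature.NumberTheory.GaloisRepresentations.contOneCocycles` and their classes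
`oneCocycleClass`, file `GaloisRepresentations/ContinuousH1`; restriction to a subgroup
`resSubgroupH1`, conjugation `conjH1`, and `liftH1` — maps out of `H¹` defined on cocycles — of
files `SubgroupSelmer`, `H1CorestrictionIndexTwo`). The sibling file `H1CorestrictionIndexTwo`
treats the transversal `{1, c}` of an index-`2` normal subgroup; this file treats an arbitrary
open subgroup `N ≤ G` of finite index and an arbitrary system `s : G ⧸ N → G` of left coset
representatives:

* `schreierElt N hs g x = s(g • x)⁻¹ g s(x) ∈ N` (`g ∈ G`, `x ∈ G ⧸ N`), with the cocycle rule
  `schreierElt (g₁ g₂) x = schreierElt g₁ (g₂ • x) · schreierElt g₂ x`;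
* `coresFun`, `coresCocycle` — the **transfer (corestriction) on crossed homomorphisms**
  `(cor f)(g) = Σ_{x ∈ G/N} s(g • x) • f(s(g • x)⁻¹ g s(x))`, a continuous crossed homomorphism
  on `G` (`coresFun_mul`, `continuous_coresFun`);
* `coresH1With N hN hs : H¹(N, M) →+ H¹(G, M)` — the **corestriction**, well defined since the
  transfer of the coboundary of `m` is the coboundary of `Σ_x s(x) • m` (`coresFun_of_coboundary`),
  and INDEPENDENT of the coset representatives (`coresH1With_eq_coresH1With`: two transfers of the
  same cocycle differ by the coboundary of `Σ_x s(x) • f(s(x)⁻¹ s'(x))`); `coresH1 N hN` is the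
  choice `s = Quotient.out`;
* `coresH1_resSubgroupH1` — **`cor ∘ res = (G : N)`** (Serre, *Galois Cohomology*, I.§2.4, whence
  Prop. 9: the kernel of `res` is killed by `(G : N)`; *Local Fields*, VII.§7, Prop. 6): on
  cocycles the transfer of `f|_N` is `(G : N) f + ∂(Σ_x f(s x))`;
* `resSubgroupH1_coresH1With`, `ClarkSharif2010_lemma15` — for `N` NORMAL,
  **`res ∘ cores = Nm := Σ_{ḡ ∈ G/N} ḡ_*`**, the sum of the conjugation actions `conjH1 N M (s x)`
  over any system of representatives (Clark–Sharif 2010, Lemma 15: "If `θ ∈ H¹(K_P, E[P])`,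
  then `res ∘ cores θ = Nm θ`", `Nm(θ)(σ) = Σ_{γ̄ ∈ Gal(K_P/K)} γ · θ(γ⁻¹ σ γ)` "where `γ` is a
  fixed lift of `γ̄` to `𝔤_K`"; there deduced from the definition of `cores` on `H⁰` and dimension
  shifting, here read off from the transfer formula: for `n ∈ N`, `n • x = x` and
  `schreierElt n x = s(x)⁻¹ n s(x)`).

This is the corestriction `cores_{K_P/K} : H¹(K_P, E[P]) → H¹(K, E[P])` (`G = 𝔤_K`,
`N = 𝔤_{K_P}` open of index `[K_P : K]`) by which Clark–Sharif define the classes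
`ξ_n = cores θ_n` in the proof of their Theorem 2 (§3.3, §3.5), vendored as the named fact
`Literature.NumberTheory.EllipticCurves.ClarkSharif2010_thm2` of file `PeriodIndex`; Lemma 15 is the first step of its §3.5.
Everything here is proved; no named fact is introduced.

## References

* J.-P. Serre, *Galois Cohomology* (1997), I.§2.4 (Res; Cor for `H` open of finite index `n`;
  `Cor ∘ Res = n`; Prop. 9), I.§2.5 (b) (Cor via induced modules). [SerreGaloisCohomology1997]
* J.-P. Serre, *Local Fields* (1979), VII.§5 (Res, the action of `G/H` on `H^q(H, A)`, Prop. 3),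
  VII.§7 (subgroups of finite index: `N_{G/H}`, Cor, Prop. 6 `Cor ∘ Res = n`), VII.§8 (transfer).
  [SerreLocalFields1979]
* J. Neukirch, A. Schmidt, K. Wingberg, *Cohomology of Number Fields*, 2nd ed. (2008), I.§5
  (cor on inhomogeneous cochains via coset representatives; double coset formula).
  [NeukirchSchmidtWingberg2008]
* P. L. Clark, S. Sharif, *Period, index and potential Ш*, Algebra & Number Theory 4 (2010),
  §3.3 and §3.5, Lemma 15. [ClarkSharif2010]
-/

noncomputable section

open scoped Classical

universe u

namespace Literature.NumberTheory.EllipticCurves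

open GaloisRepresentations

variable {G : Type u} [Group G] [TopologicalSpace G] [IsTopologicalGroup G]

/-! ## Coset representatives and the Schreier elements `s(g • x)⁻¹ g s(x)` -/

section Schreier

variable (N : Subgroup G) {s : G ⧸ N → G}

omit [TopologicalSpace G] [IsTopologicalGroup G] in
/-- For a system of left coset representatives `s` (`s(x) N = x`) the element
`s(g • x)⁻¹ g s(x)` lies in `N` (both `s(g • x)` and `g s(x)` represent `g • x`).
Serre, *Local Fields*, VII.§8; Neukirch–Schmidt–Wingberg, I.§5. [folklore] -/
theorem schreierElt_mem (hs : ∀ x : G ⧸ N, (s x : G ⧸ N) = x) (g : G) (x : G ⧸ N) :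
    (s (g • x))⁻¹ * g * s x ∈ N := by
  have h : (s (g • x) : G ⧸ N) = ((g * s x : G) : G ⧸ N) := by
    rw [hs, ← smul_eq_mul, ← MulAction.Quotient.smul_coe, hs]
  rw [mul_assoc]
  exact QuotientGroup.eq.mp h

omit [TopologicalSpace G] [IsTopologicalGroup G] in
/-- The Schreier element `s(g • x)⁻¹ g s(x) ∈ N` of `g ∈ G` at the coset `x ∈ G ⧸ N`, for a system
of left coset representatives `s`. Serre, *Local Fields*, VII.§8; Neukirch–Schmidt–Wingberg,
I.§5. [folklore] -/
def schreierElt (hs : ∀ x : G ⧸ N, (s x : G ⧸ N) = x) (g : G) (x : G ⧸ N) : N :=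
  ⟨(s (g • x))⁻¹ * g * s x, schreierElt_mem N hs g x⟩

omit [TopologicalSpace G] [IsTopologicalGroup G] in
/-- `schreierElt` in `G`. [folklore] -/
@[simp]
theorem schreierElt_coe (hs : ∀ x : G ⧸ N, (s x : G ⧸ N) = x) (g : G) (x : G ⧸ N) :
    ((schreierElt N hs g x : N) : G) = (s (g • x))⁻¹ * g * s x :=
  rfl

omit [TopologicalSpace G] [IsTopologicalGroup G] in
/-- `s(g • x) · schreierElt g x = g s(x)`. [folklore] -/
theorem rep_mul_schreierElt (hs : ∀ x : G ⧸ N, (s x : G ⧸ N) = x) (g : G) (x : G ⧸ N) :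
    s (g • x) * (schreierElt N hs g x : G) = g * s x := by
  rw [schreierElt_coe, mul_assoc, mul_inv_cancel_left]

omit [TopologicalSpace G] [IsTopologicalGroup G] in
/-- **The cocycle rule** `schreierElt (g₁ g₂) x = schreierElt g₁ (g₂ • x) · schreierElt g₂ x`.
Serre, *Local Fields*, VII.§8. [folklore] -/
theorem schreierElt_mul (hs : ∀ x : G ⧸ N, (s x : G ⧸ N) = x) (g₁ g₂ : G) (x : G ⧸ N) :
    schreierElt N hs (g₁ * g₂) x = schreierElt N hs g₁ (g₂ • x) * schreierElt N hs g₂ x := by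
  apply Subtype.ext
  simp only [schreierElt_coe, Subgroup.coe_mul, mul_smul]
  group

omit [TopologicalSpace G] [IsTopologicalGroup G] in
/-- Two representatives of the same coset differ by an element of `N`: `s(x)⁻¹ s'(x) ∈ N`.
[folklore] -/
theorem rep_inv_mul_rep_mem (hs : ∀ x : G ⧸ N, (s x : G ⧸ N) = x) {s' : G ⧸ N → G}
    (hs' : ∀ x : G ⧸ N, (s' x : G ⧸ N) = x) (x : G ⧸ N) : (s x)⁻¹ * s' x ∈ N :=
  QuotientGroup.eq.mp ((hs x).trans (hs' x).symm)

omit [TopologicalSpace G] [IsTopologicalGroup G] in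
/-- The change of representatives `η(x) = s(x)⁻¹ s'(x) ∈ N` between two systems `s`, `s'`.
[folklore] -/
def repChange (hs : ∀ x : G ⧸ N, (s x : G ⧸ N) = x) {s' : G ⧸ N → G}
    (hs' : ∀ x : G ⧸ N, (s' x : G ⧸ N) = x) (x : G ⧸ N) : N :=
  ⟨(s x)⁻¹ * s' x, rep_inv_mul_rep_mem N hs hs' x⟩

omit [TopologicalSpace G] [IsTopologicalGroup G] in
/-- `repChange` in `G`. [folklore] -/
@[simp]
theorem repChange_coe (hs : ∀ x : G ⧸ N, (s x : G ⧸ N) = x) {s' : G ⧸ N → G}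
    (hs' : ∀ x : G ⧸ N, (s' x : G ⧸ N) = x) (x : G ⧸ N) :
    ((repChange N hs hs' x : N) : G) = (s x)⁻¹ * s' x :=
  rfl

omit [TopologicalSpace G] [IsTopologicalGroup G] in
/-- `s(x) η(x) = s'(x)`. [folklore] -/
theorem rep_mul_repChange (hs : ∀ x : G ⧸ N, (s x : G ⧸ N) = x) {s' : G ⧸ N → G}
    (hs' : ∀ x : G ⧸ N, (s' x : G ⧸ N) = x) (x : G ⧸ N) :
    s x * (repChange N hs hs' x : G) = s' x :=
  mul_inv_cancel_left _ _

omit [TopologicalSpace G] [IsTopologicalGroup G] in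
/-- A normal subgroup acts trivially on its left coset space. [folklore] -/
theorem coe_smul_quotient_eq [N.Normal] (n : N) (x : G ⧸ N) : (n : G) • x = x := by
  induction x using QuotientGroup.induction_on with
  | H g =>
    rw [MulAction.Quotient.smul_coe, smul_eq_mul, QuotientGroup.eq, mul_inv_rev]
    have h := ‹N.Normal›.conj_mem _ (N.inv_mem n.2) g⁻¹
    rwa [inv_inv] at h

/-- For `N` normal and `n ∈ N`, the Schreier element at `x` is the conjugate `s(x)⁻¹ n s(x)`
(`subgroupConj N (s x) n`). [folklore] -/
theorem schreierElt_coe_eq_subgroupConj [N.Normal] (hs : ∀ x : G ⧸ N, (s x : G ⧸ N) = x)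
    (n : N) (x : G ⧸ N) : schreierElt N hs (n : G) x = subgroupConj N (s x) n := by
  apply Subtype.ext
  rw [schreierElt_coe, subgroupConj_apply_coe, coe_smul_quotient_eq N]

end Schreier

/-! ## The transfer on crossed homomorphisms -/

section Transfer

variable (N : Subgroup G) [Fintype (G ⧸ N)] {s : G ⧸ N → G}
variable {M : Type u} [AddCommGroup M] [DistribMulAction G M] [TopologicalSpace M]
  [DiscreteTopology M]

/-- Values of a finite sum of cocycles. [folklore] -/
theorem sum_apply_val {H : Type u} [Group H] [TopologicalSpace H] [DistribMulAction H M]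
    {ι : Type*} (S : Finset ι) (F : ι → contOneCocycles (discreteTopRep H M)) (y : H) :
    (∑ i ∈ S, F i).1 y = ∑ i ∈ S, (F i).1 y := by
  induction S using Finset.cons_induction with
  | empty => simp
  | cons a S ha ih => rw [Finset.sum_cons, Finset.sum_cons, add_apply_val, ih]

/-- The transfer of a crossed homomorphism `f` on `N` to `G`, as a bare function:
`(cor f)(g) = Σ_{x ∈ G/N} s(g • x) • f(s(g • x)⁻¹ g s(x))`. Neukirch–Schmidt–Wingberg, I.§5
(corestriction on inhomogeneous cochains); Serre, *Local Fields*, VII.§7–§8. [folklore] -/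
def coresFun (hs : ∀ x : G ⧸ N, (s x : G ⧸ N) = x) (f : contOneCocycles (discreteTopRep N M))
    (g : G) : M :=
  ∑ x : G ⧸ N, s (g • x) • f.1 (schreierElt N hs g x)

omit [IsTopologicalGroup G] in
/-- Unfolding `coresFun`. [folklore] -/
theorem coresFun_apply (hs : ∀ x : G ⧸ N, (s x : G ⧸ N) = x)
    (f : contOneCocycles (discreteTopRep N M)) (g : G) :
    coresFun N hs f g = ∑ x : G ⧸ N, s (g • x) • f.1 (schreierElt N hs g x) :=
  rfl

omit [IsTopologicalGroup G] in
/-- **The transfer is a crossed homomorphism on `G`**: `F(g₁ g₂) = F(g₁) + g₁ • F(g₂)`, by the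
cocycle rule for the Schreier elements and reindexing the sum along `x ↦ g₂ • x`.
Neukirch–Schmidt–Wingberg, I.§5. [folklore] -/
theorem coresFun_mul (hs : ∀ x : G ⧸ N, (s x : G ⧸ N) = x)
    (f : contOneCocycles (discreteTopRep N M)) (g₁ g₂ : G) :
    coresFun N hs f (g₁ * g₂) = coresFun N hs f g₁ + g₁ • coresFun N hs f g₂ := by
  simp only [coresFun_apply]
  have key : ∀ x : G ⧸ N, s ((g₁ * g₂) • x) • f.1 (schreierElt N hs (g₁ * g₂) x) =
      s (g₁ • (g₂ • x)) • f.1 (schreierElt N hs g₁ (g₂ • x)) +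
        g₁ • (s (g₂ • x) • f.1 (schreierElt N hs g₂ x)) := fun x ↦ by
    rw [schreierElt_mul, cocycle_mul, smul_add, mul_smul g₁ g₂ x,
      smul_smul (s (g₁ • g₂ • x)) ((schreierElt N hs g₁ (g₂ • x) : N) : G), rep_mul_schreierElt,
      smul_smul g₁ (s (g₂ • x))]
  rw [Finset.sum_congr rfl fun x _ ↦ key x, Finset.sum_add_distrib, Finset.smul_sum]
  congr 1
  exact Equiv.sum_comp (MulAction.toPerm g₂)
    (fun y ↦ s (g₁ • y) • f.1 (schreierElt N hs g₁ y))

/-- **The transfer is continuous** (`N` open: `G ⧸ N` is discrete, so `g ↦ s(g • x)` and the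
Schreier elements are continuous in `g`; `M` is discrete). [folklore] -/
theorem continuous_coresFun (hN : IsOpen (N : Set G)) (hs : ∀ x : G ⧸ N, (s x : G ⧸ N) = x)
    (f : contOneCocycles (discreteTopRep N M)) : Continuous (coresFun N hs f) := by
  haveI : DiscreteTopology (G ⧸ N) := QuotientGroup.discreteTopology hN
  have hsm : ∀ x : G ⧸ N, Continuous fun g : G ↦ g • x := fun x ↦
    continuous_id.smul continuous_const
  have hrep : ∀ x : G ⧸ N, Continuous fun g : G ↦ s (g • x) := fun x ↦
    continuous_of_discreteTopology.comp (hsm x)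
  have hsch : ∀ x : G ⧸ N, Continuous fun g : G ↦ schreierElt N hs g x := fun x ↦
    Continuous.subtype_mk (((hrep x).inv.mul continuous_id).mul continuous_const)
      fun g ↦ schreierElt_mem N hs g x
  have hpair : Continuous fun g : G ↦ fun x : G ⧸ N ↦
      ((g • x, f.1 (schreierElt N hs g x)) : (G ⧸ N) × M) :=
    continuous_pi fun x ↦ (hsm x).prodMk (f.1.continuous.comp (hsch x))
  have e : coresFun N hs f =
      (fun F : G ⧸ N → (G ⧸ N) × M ↦ ∑ x : G ⧸ N, s (F x).1 • (F x).2) ∘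
        fun g : G ↦ fun x : G ⧸ N ↦ ((g • x, f.1 (schreierElt N hs g x)) : (G ⧸ N) × M) := by
    funext g
    rfl
  rw [e]
  exact continuous_of_discreteTopology.comp hpair

/-- **Corestriction on cocycles** along the open subgroup `N` of finite index, for the system of
representatives `s`: the transfer `coresFun` as a continuous crossed homomorphism `G → M`.
Serre, *Galois Cohomology*, I.§2.4; Neukirch–Schmidt–Wingberg, I.§5. [folklore] -/
def coresCocycle (hN : IsOpen (N : Set G)) (hs : ∀ x : G ⧸ N, (s x : G ⧸ N) = x)
    (f : contOneCocycles (discreteTopRep N M)) : contOneCocycles (discreteTopRep G M) :=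
  ⟨⟨coresFun N hs f, continuous_coresFun N hN hs f⟩, fun g₁ g₂ ↦ coresFun_mul N hs f g₁ g₂⟩

/-- Values of `coresCocycle`. [folklore] -/
@[simp]
theorem coresCocycle_apply (hN : IsOpen (N : Set G)) (hs : ∀ x : G ⧸ N, (s x : G ⧸ N) = x)
    (f : contOneCocycles (discreteTopRep N M)) (g : G) :
    (coresCocycle N hN hs f).1 g = coresFun N hs f g :=
  rfl

omit [IsTopologicalGroup G] in
/-- The transfer is additive in the cocycle. [folklore] -/
theorem coresFun_add (hs : ∀ x : G ⧸ N, (s x : G ⧸ N) = x)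
    (f₁ f₂ : contOneCocycles (discreteTopRep N M)) (g : G) :
    coresFun N hs (f₁ + f₂) g = coresFun N hs f₁ g + coresFun N hs f₂ g := by
  rw [coresFun_apply, coresFun_apply, coresFun_apply, ← Finset.sum_add_distrib]
  refine Finset.sum_congr rfl fun x _ ↦ ?_
  rw [add_apply_val, smul_add]

/-- Corestriction on cocycles as an additive homomorphism `Z¹(N, M) → Z¹(G, M)`. [folklore] -/
def coresCocycleHom (hN : IsOpen (N : Set G)) (hs : ∀ x : G ⧸ N, (s x : G ⧸ N) = x) :
    contOneCocycles (discreteTopRep N M) →+ contOneCocycles (discreteTopRep G M) :=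
  AddMonoidHom.mk' (coresCocycle N hN hs) fun f₁ f₂ ↦
    Subtype.ext (ContinuousMap.ext fun g ↦ coresFun_add N hs f₁ f₂ g)

/-- `coresCocycleHom` is `coresCocycle`. [folklore] -/
@[simp]
theorem coresCocycleHom_apply (hN : IsOpen (N : Set G)) (hs : ∀ x : G ⧸ N, (s x : G ⧸ N) = x)
    (f : contOneCocycles (discreteTopRep N M)) :
    coresCocycleHom N hN hs f = coresCocycle N hN hs f :=
  rfl

omit [IsTopologicalGroup G] in
/-- **The transfer of a coboundary is a coboundary**: if `f(n) = n • m - m` on `N` then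
`(cor f)(g) = g • m' - m'` with `m' = Σ_x s(x) • m`. Neukirch–Schmidt–Wingberg, I.§5. [folklore] -/
theorem coresFun_of_coboundary (hs : ∀ x : G ⧸ N, (s x : G ⧸ N) = x)
    (f : contOneCocycles (discreteTopRep N M)) (m : M) (hm : ∀ n : N, f.1 n = (n : G) • m - m)
    (g : G) :
    coresFun N hs f g = g • (∑ x : G ⧸ N, s x • m) - ∑ x : G ⧸ N, s x • m := by
  rw [coresFun_apply]
  have key : ∀ x : G ⧸ N, s (g • x) • f.1 (schreierElt N hs g x) =
      g • (s x • m) - s (g • x) • m := fun x ↦ by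
    rw [hm, smul_sub, smul_smul, rep_mul_schreierElt, mul_smul]
  rw [Finset.sum_congr rfl fun x _ ↦ key x, Finset.sum_sub_distrib, Finset.smul_sum]
  congr 1
  exact Equiv.sum_comp (MulAction.toPerm g) (fun y ↦ s y • m)

/-- **Corestriction** `cores : H¹(N, M) → H¹(G, M)` along the open subgroup `N` of finite index,
computed with the system of left coset representatives `s` (well defined on classes by
`coresFun_of_coboundary`; independent of `s` by `coresH1With_eq_coresH1With`).
Serre, *Galois Cohomology*, I.§2.4; *Local Fields*, VII.§7; Neukirch–Schmidt–Wingberg, I.§5.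
[folklore] -/
def coresH1With (hN : IsOpen (N : Set G)) (hs : ∀ x : G ⧸ N, (s x : G ⧸ N) = x) :
    subgroupH1 N M →+ discreteH1 G M :=
  liftH1 ((classHom G M).comp (coresCocycleHom N hN hs)) fun f hf ↦ by
    obtain ⟨m, hm⟩ := (oneCocycleClass_eq_zero_iff _ f).mp hf
    rw [AddMonoidHom.coe_comp, Function.comp_apply, coresCocycleHom_apply, classHom_apply,
      oneCocycleClass_eq_zero_iff]
    refine ⟨∑ x : G ⧸ N, s x • m, fun g ↦ ?_⟩
    change coresFun N hs f g = g • (∑ x : G ⧸ N, s x • m) - ∑ x : G ⧸ N, s x • m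
    exact coresFun_of_coboundary N hs f m (fun n ↦ hm n) g

/-- `cores_s [f] = [coresCocycle_s f]`. [folklore] -/
@[simp]
theorem coresH1With_oneCocycleClass (hN : IsOpen (N : Set G))
    (hs : ∀ x : G ⧸ N, (s x : G ⧸ N) = x) (f : contOneCocycles (discreteTopRep N M)) :
    coresH1With N hN hs (oneCocycleClass (discreteTopRep N M) f) =
      oneCocycleClass (discreteTopRep G M) (coresCocycle N hN hs f) := by
  rw [coresH1With, liftH1_oneCocycleClass]
  rfl

/-! ## Independence of the coset representatives -/

omit [IsTopologicalGroup G] in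
/-- **Changing the representatives changes the transfer by a coboundary**: with
`η(x) = s(x)⁻¹ s'(x) ∈ N` (`repChange`) and `m = Σ_x s(x) • f(η(x))`,
`(cor_{s'} f)(g) = (cor_s f)(g) + g • m - m`. Neukirch–Schmidt–Wingberg, I.§5. [folklore] -/
theorem coresFun_eq_coresFun_add (hs : ∀ x : G ⧸ N, (s x : G ⧸ N) = x) {s' : G ⧸ N → G}
    (hs' : ∀ x : G ⧸ N, (s' x : G ⧸ N) = x) (f : contOneCocycles (discreteTopRep N M)) (g : G) :
    coresFun N hs' f g = coresFun N hs f g +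
      (g • (∑ x : G ⧸ N, s x • f.1 (repChange N hs hs' x)) -
        ∑ x : G ⧸ N, s x • f.1 (repChange N hs hs' x)) := by
  -- `schreierElt' g x = η(g • x)⁻¹ · schreierElt g x · η(x)`
  have hsch : ∀ x, schreierElt N hs' g x =
      (repChange N hs hs' (g • x))⁻¹ * (schreierElt N hs g x * repChange N hs hs' x) :=
    fun x ↦ by
    apply Subtype.ext
    simp only [schreierElt_coe, Subgroup.coe_mul, Subgroup.coe_inv, repChange_coe, mul_inv_rev,
      inv_inv]
    group
  have key : ∀ x : G ⧸ N, s' (g • x) • f.1 (schreierElt N hs' g x) =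
      -(s (g • x) • f.1 (repChange N hs hs' (g • x))) +
        s (g • x) • f.1 (schreierElt N hs g x) + g • (s x • f.1 (repChange N hs hs' x)) :=
    fun x ↦ by
    rw [hsch, cocycle_mul, cocycle_mul, cocycle_inv, ← rep_mul_repChange N hs hs' (g • x)]
    simp only [smul_add, smul_neg, smul_smul, Subgroup.coe_inv, mul_assoc, mul_inv_cancel_left,
      mul_inv_cancel, mul_one, rep_mul_schreierElt]
    abel
  have hre : ∑ x : G ⧸ N, s (g • x) • f.1 (repChange N hs hs' (g • x)) =
      ∑ y : G ⧸ N, s y • f.1 (repChange N hs hs' y) :=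
    Equiv.sum_comp (MulAction.toPerm g) (fun y ↦ s y • f.1 (repChange N hs hs' y))
  rw [coresFun_apply, coresFun_apply, Finset.sum_congr rfl fun x _ ↦ key x,
    Finset.sum_add_distrib, Finset.sum_add_distrib, Finset.sum_neg_distrib, Finset.smul_sum, hre]
  abel

/-- **Corestriction does not depend on the coset representatives.**
Serre, *Galois Cohomology*, I.§2.4; Neukirch–Schmidt–Wingberg, I.§5. [folklore] -/
theorem coresH1With_eq_coresH1With (hN : IsOpen (N : Set G))
    (hs : ∀ x : G ⧸ N, (s x : G ⧸ N) = x) {s' : G ⧸ N → G}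
    (hs' : ∀ x : G ⧸ N, (s' x : G ⧸ N) = x) :
    coresH1With (M := M) N hN hs' = coresH1With N hN hs := by
  ext ξ
  obtain ⟨f, rfl⟩ := oneCocycleClass_surjective _ ξ
  rw [coresH1With_oneCocycleClass, coresH1With_oneCocycleClass, ← sub_eq_zero,
    ← oneCocycleClass_sub, oneCocycleClass_eq_zero_iff]
  refine ⟨∑ x : G ⧸ N, s x • f.1 (repChange N hs hs' x), fun g ↦ ?_⟩
  change (coresCocycle N hN hs' f - coresCocycle N hN hs f).1 g =
    g • (∑ x : G ⧸ N, s x • f.1 (repChange N hs hs' x)) -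
      ∑ x : G ⧸ N, s x • f.1 (repChange N hs hs' x)
  rw [sub_apply_val, coresCocycle_apply, coresCocycle_apply, coresFun_eq_coresFun_add N hs hs' f g]
  abel

/-- **Corestriction** `cores : H¹(N, M) → H¹(G, M)` along the open subgroup `N` of finite index
(the representatives `Quotient.out`; any other system gives the same map,
`coresH1With_eq_coresH1`). Serre, *Galois Cohomology*, I.§2.4; *Local Fields*, VII.§7;
Neukirch–Schmidt–Wingberg, I.§5. [folklore] -/
def coresH1 (hN : IsOpen (N : Set G)) : subgroupH1 N M →+ discreteH1 G M :=
  coresH1With N hN (s := Quotient.out) QuotientGroup.out_eq'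

/-- Every system of representatives computes `coresH1`. [folklore] -/
theorem coresH1With_eq_coresH1 (hN : IsOpen (N : Set G))
    (hs : ∀ x : G ⧸ N, (s x : G ⧸ N) = x) : coresH1With (M := M) N hN hs = coresH1 N hN :=
  coresH1With_eq_coresH1With N hN QuotientGroup.out_eq' hs

/-- `cores [f] = [coresCocycle_s f]` for every system of representatives `s`. [folklore] -/
theorem coresH1_oneCocycleClass (hN : IsOpen (N : Set G)) (hs : ∀ x : G ⧸ N, (s x : G ⧸ N) = x)
    (f : contOneCocycles (discreteTopRep N M)) :
    coresH1 N hN (oneCocycleClass (discreteTopRep N M) f) =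
      oneCocycleClass (discreteTopRep G M) (coresCocycle N hN hs f) := by
  rw [← coresH1With_eq_coresH1 N hN hs, coresH1With_oneCocycleClass]

/-! ## `cor ∘ res = (G : N)` -/

/-- **`cor ∘ res = (G : N)`** on `H¹_cont(G, M)`, for every system of representatives: on
cocycles, the transfer of `f|_N` is `(G : N) • f + ∂(Σ_x f(s x))`, since
`s(g • x) • f(s(g • x)⁻¹ g s(x)) = f(g) + g • f(s x) - f(s(g • x))`.
Serre, *Galois Cohomology*, I.§2.4 ("On a `Cor ∘ Res = n`"); *Local Fields*, VII.§7, Prop. 6.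
[folklore] -/
theorem coresH1With_resSubgroupH1 (hN : IsOpen (N : Set G))
    (hs : ∀ x : G ⧸ N, (s x : G ⧸ N) = x) (η : discreteH1 G M) :
    coresH1With N hN hs (resSubgroupH1 N M η) = Fintype.card (G ⧸ N) • η := by
  obtain ⟨f, rfl⟩ := oneCocycleClass_surjective _ η
  have hns : oneCocycleClass (discreteTopRep G M) (Fintype.card (G ⧸ N) • f) =
      Fintype.card (G ⧸ N) • oneCocycleClass (discreteTopRep G M) f :=
    map_nsmul (oneCocycleClassₗ (discreteTopRep G M)) _ f
  rw [resSubgroupH1_oneCocycleClass, coresH1With_oneCocycleClass, ← sub_eq_zero, ← hns,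
    ← oneCocycleClass_sub, oneCocycleClass_eq_zero_iff]
  refine ⟨∑ x : G ⧸ N, f.1 (s x), fun g ↦ ?_⟩
  change (coresCocycle N hN hs (resCocycle N f) - Fintype.card (G ⧸ N) • f).1 g =
    g • (∑ x : G ⧸ N, f.1 (s x)) - ∑ x : G ⧸ N, f.1 (s x)
  rw [sub_apply_val, nsmul_apply_val, coresCocycle_apply, coresFun_apply]
  have hx : ∀ x : G ⧸ N, s (g • x) • (resCocycle N f).1 (schreierElt N hs g x) =
      f.1 g + (g • f.1 (s x) - f.1 (s (g • x))) := fun x ↦ by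
    rw [resCocycle_apply, schreierElt_coe, cocycle_mul', cocycle_mul', cocycle_inv']
    simp only [smul_add, smul_neg, smul_smul, mul_inv_cancel, one_smul, mul_inv_cancel_left]
    abel
  have hre : ∑ x : G ⧸ N, f.1 (s (g • x)) = ∑ y : G ⧸ N, f.1 (s y) :=
    Equiv.sum_comp (MulAction.toPerm g) (fun y ↦ f.1 (s y))
  rw [Finset.sum_congr rfl fun x _ ↦ hx x, Finset.sum_add_distrib, Finset.sum_const,
    Finset.card_univ, Finset.sum_sub_distrib, Finset.smul_sum, hre]
  abel

/-- **`cor ∘ res = (G : N)`** on `H¹_cont(G, M)`. Serre, *Galois Cohomology*, I.§2.4;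
*Local Fields*, VII.§7, Prop. 6. [folklore] -/
theorem coresH1_resSubgroupH1 (hN : IsOpen (N : Set G)) (η : discreteH1 G M) :
    coresH1 N hN (resSubgroupH1 N M η) = Fintype.card (G ⧸ N) • η :=
  coresH1With_resSubgroupH1 N hN QuotientGroup.out_eq' η

/-- `cor ∘ res` is multiplication by the index `(G : N)`. Serre, *Galois Cohomology*, I.§2.4;
*Local Fields*, VII.§7, Prop. 6. [folklore] -/
theorem coresH1_resSubgroupH1_eq_index_nsmul (hN : IsOpen (N : Set G)) (η : discreteH1 G M) :
    coresH1 N hN (resSubgroupH1 N M η) = N.index • η := by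
  rw [coresH1_resSubgroupH1, Subgroup.index_eq_card, Nat.card_eq_fintype_card]

/-- **Serre, *Galois Cohomology*, I.§2.4, Prop. 9** (degree one): the kernel of
`res : H¹(G, M) → H¹(N, M)` is killed by the index `(G : N)`. [folklore] -/
theorem index_nsmul_eq_zero_of_resSubgroupH1_eq_zero (hN : IsOpen (N : Set G))
    {η : discreteH1 G M} (hη : resSubgroupH1 N M η = 0) : N.index • η = 0 := by
  rw [← coresH1_resSubgroupH1_eq_index_nsmul N hN, hη, map_zero]

/-! ## `res ∘ cores = Nm` for a normal subgroup (Clark–Sharif 2010, Lemma 15) -/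

variable [N.Normal]

/-- On cocycles, for `N` normal: the restriction to `N` of the transfer of `f` is the sum of the
conjugates `(s(x) · f)(n) = s(x) • f(s(x)⁻¹ n s(x))` over the representatives (for `n ∈ N`,
`n • x = x` and the Schreier element is `s(x)⁻¹ n s(x)`). [folklore] -/
theorem resCocycle_coresCocycle (hN : IsOpen (N : Set G)) (hs : ∀ x : G ⧸ N, (s x : G ⧸ N) = x)
    (f : contOneCocycles (discreteTopRep N M)) :
    resCocycle N (coresCocycle N hN hs f) = ∑ x : G ⧸ N, conjCocycle N (s x) f := by
  apply Subtype.ext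
  ext n
  rw [resCocycle_apply, coresCocycle_apply, coresFun_apply, sum_apply_val]
  refine Finset.sum_congr rfl fun x _ ↦ ?_
  rw [conjCocycle_apply, schreierElt_coe_eq_subgroupConj N hs, coe_smul_quotient_eq N]

/-- **`res ∘ cores = Nm`** for an open normal subgroup `N` of finite index, with the
representatives `s`: `res (cores_s ξ) = Σ_{x ∈ G/N} (s x)_* ξ`, the sum of the conjugation
actions `conjH1 N M (s x)`. Serre, *Local Fields*, VII.§5 and VII.§7; Neukirch–Schmidt–Wingberg,
I.§5 (double coset formula with `N` normal). [folklore] -/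
theorem resSubgroupH1_coresH1With (hN : IsOpen (N : Set G))
    (hs : ∀ x : G ⧸ N, (s x : G ⧸ N) = x) (ξ : subgroupH1 N M) :
    resSubgroupH1 N M (coresH1With N hN hs ξ) = ∑ x : G ⧸ N, conjH1 N M (s x) ξ := by
  obtain ⟨f, rfl⟩ := oneCocycleClass_surjective _ ξ
  rw [coresH1With_oneCocycleClass, resSubgroupH1_oneCocycleClass,
    resCocycle_coresCocycle N hN hs, ← oneCocycleClassₗ_apply, map_sum]
  refine Finset.sum_congr rfl fun x _ ↦ ?_
  rw [oneCocycleClassₗ_apply, conjH1_oneCocycleClass]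

/-- **`res ∘ cores = Nm`** for an open normal subgroup `N` of finite index: for EVERY system `s`
of coset representatives, `res (cores ξ) = Σ_{x ∈ G/N} (s x)_* ξ` (each conjugation action
`conjH1 N M g` only depends on the coset `g N`, inner automorphisms acting trivially on `H¹(N, M)`).
Serre, *Local Fields*, VII.§5 and VII.§7; Neukirch–Schmidt–Wingberg, I.§5. [folklore] -/
theorem resSubgroupH1_coresH1 (hN : IsOpen (N : Set G)) (hs : ∀ x : G ⧸ N, (s x : G ⧸ N) = x)
    (ξ : subgroupH1 N M) :
    resSubgroupH1 N M (coresH1 N hN ξ) = ∑ x : G ⧸ N, conjH1 N M (s x) ξ := by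
  rw [← coresH1With_eq_coresH1 N hN hs]
  exact resSubgroupH1_coresH1With N hN hs ξ

/-- **Clark–Sharif 2010, Lemma 15** ("If `θ ∈ H¹(K_P, E[P])`, then `res ∘ cores θ = Nm θ`",
with `Nm(θ)(σ) = Σ_{γ̄ ∈ Gal(K_P/K)} γ · θ(γ⁻¹ σ γ)`, "where `γ` is a fixed lift of `γ̄` to
`𝔤_K`"; printed proof: "The lemma follows from the definition of `cores` on `H⁰(K_P, E[P])` and
dimension shifting; see for example [CL]", i.e. Serre, *Corps locaux*, VII.§7), in the
generality of an open normal subgroup `N` of finite index of a topological group `G`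
(`G = 𝔤_K`, `N = 𝔤_{K_P}`, `G ⧸ N = Gal(K_P/K)`) and a discrete `G`-module `M` (`= E[P]`): for
every choice `s` of lifts of the elements of `G ⧸ N`,
`res (cores θ) = Σ_{x ∈ G ⧸ N} (s x)_* θ`, where `((s x)_* θ)(σ) = s(x) • θ(s(x)⁻¹ σ s(x))`
(`conjH1`; on cocycles `conjCocycle_apply`). [cite: ClarkSharif2010, Lemma 15] -/
theorem ClarkSharif2010_lemma15 (hN : IsOpen (N : Set G)) (hs : ∀ x : G ⧸ N, (s x : G ⧸ N) = x)
    (θ : subgroupH1 N M) :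
    resSubgroupH1 N M (coresH1 N hN θ) = ∑ x : G ⧸ N, conjH1 N M (s x) θ :=
  resSubgroupH1_coresH1 N hN hs θ

end Transfer

end Literature.NumberTheory.EllipticCurves

end
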